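import Mathlib
import HarnessLib
import Summits.HubbardSuperconductivity.HubbardSuperconductivity.Theorems.KLProgrammeKLRegimeSectorMultiplierFrameDiffs
import Summits.HubbardSuperconductivity.HubbardSuperconductivity.Theorems.KLProgrammeKLRegimeTorusL1MixedDifferencesMoment
import Summits.HubbardSuperconductivity.HubbardSuperconductivity.Theorems.KLProgrammeKLRegimeSymbolIncrementLine

/-!
# K3 VL child `KLRegimeVolumeLimitV17F2` (stmt-HubbardSuperconductivity-20440), located item #23 «W2-HALF-VL», brick «W2H-OVL» part 5 (WEIGHTED ℓ¹):
# the WEIGHTED `ℓ¹` norm (one position moment) of the space-time character sum of the thin-pair FRAME DIFFERENCE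
# `D = F^{K′}_{ω₁}F^{K′}_{ω₂} − F^{K}_{ω₁}F^{K}_{ω₂}` from the pointwise data of its two increment pairs — the master-lemma packaging

Cell `gate-hubbard-kl`, seat p3 (g14), lead of #23.  The thin-pair frame difference splits into two increment pairs
(`klAnisoPairDiff_eq_incr_sub_incr`, `…ThinMultiplierIncrementPairSymbol`): `D = G₁ − G₂`, `G₁` = increment in `ω₁` on the base `K`, `G₂` = increment in
`ω₂` on the base `K′`; their pointwise single-direction differences (orders ≤ 3: time, axes, normal step, tangent step at the isotropic and at the
anisotropic slot) are `norm_fwdDiff_iter_{time,space,tangent}_thinIncrPair_le` (`…ThinMultiplierIncrementPair{Time,Space,Tangent}`), their sups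
`norm_thinIncrPairSymbol_le` — all LINEAR in the jets of the piece `ν = e_K − e_{K′}`.  This file is the packaging step, free of the model's constants:
GIVEN such pointwise bounds for `G₁`, `G₂` (abstract reals), free rates `s₀ s₁ s₂ s₃ s₃′`, a tangent step `v ≠ 0` with near radius `R₀`, an amplitude `A₀`
and the six THRESHOLD inequalities putting the summed bounds in the master lemma's currency `A₀·(4/(s·P))^N`, the mixed master lemma
`sum_wt_norm_charSum_le_of_mixed_differences` (p3 g10, `…TorusL1MixedDifferencesMoment`) and k3c4-p2's support count of `D`
(`card_support_thinPairDiff_le`, twice p4's pair count) give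

* **`charSumWt_thinPairDiff_le_of_pointwise`** —
  `Σ_z (1 + s₀|z̃₁| + s₁|z̃₂⁰| + s₁|z̃₂¹|)·‖Σ_q χ_{q₁}(z₁)χ_{q₂}(z₂) • D(q)‖ ≤ √(524288(1/s₀+1)[C_w′²(2√2/(s₂|v|)+2)(2√2/(s₃|v|)+2) + (1/s₁+1)²/(1+s₁R₀)])·√(24·2M·L²·N^Δ)·A₀`,
  `N^Δ = 2 ×` p4's pair count, `C_w′ = 1 + 2√2 s₁/(s₂|v|) + 2√2 s₁/(s₃′|v|)`.

The thresholds are solved in the two-scale class by the rate file; the pointwise hypotheses are discharged along the flow chain by the regime file.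
Everything is proved; no definitions, no sorry.  Nothing asserts any stub, K3, VL or superconductivity.
[cite: BenfattoGiulianiMastropietro2006, Lemma 2.2 (2.52)–(2.55), §2.6 (2.81) and footnote 1, §2.7 (2.71a), §3 (3.3)]
-/

noncomputable section

namespace Summit.HubbardSuperconductivity.HubbardSuperconductivity.Theorems.TorusFourierL2

set_option linter.dupNamespace false -- summit = problem name (single-conjunct summit), D-0017

open Set Finset Literature.MathematicalPhysics.QuantumLattice Literature.MathematicalPhysics.QuantumLattice.BandSectorCounting
open Literature.MathematicalPhysics.QuantumLattice.FermiRG Literature.Probability.LatticeModels Literature.Analysis.SpecialFunctions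
open Summit.HubbardSuperconductivity.HubbardSuperconductivity.Theorems.DispersionFlow
open Summit.HubbardSuperconductivity.HubbardSuperconductivity.Theorems.KLRegimeSplit
open Summit.HubbardSuperconductivity.HubbardSuperconductivity.Theorems.KLProgrammeLegKernels
open Summit.HubbardSuperconductivity.HubbardSuperconductivity.Theorems.PerturbedFermiCurve
open scoped Real

section ThinPairDiffWt

variable {L M : ℕ} [NeZero L] [NeZero M] {a b : ℝ} (B : BandBounds a b) {K K' : TrigPolyC4v} {A : ℝ}
  (hA : ∀ p : Momentum, ∀ j ≤ 2, ‖iteratedFDeriv ℝ j (frameShift K) p‖ ≤ A)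
  (hA' : ∀ p : Momentum, ∀ j ≤ 2, ‖iteratedFDeriv ℝ j (frameShift K') p‖ ≤ A) (hADt : 2 * A < B.Dtmin)
  {μ e₀ z β : ℝ} (he : 0 < e₀) (hz : 0 < z) (hz1 : z ≤ 1) (hgap : e₀ + A + z ^ 2 < -μ) (h3 : e₀ + A - μ ≤ 3)
  (hlo : a ≤ μ - A - e₀) (hhi : μ + A + e₀ ≤ b) (hβ : 0 < β) (hρA : 4 * A < 2 * B.rhomin)
  {n₁ n₂ : ℕ} (hn : n₂ ≤ n₁) (ω₁ : Fin (sectorCount n₁)) (ω₂ : Fin (sectorCount n₂))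
  {d : ℝ} (hd : 0 ≤ d) (hd1 : ∀ u, |deriv (bgmCutoffSq e₀) u| ≤ d) (hd2 : ∀ u, |iteratedDeriv 2 (bgmCutoffSq e₀) u| ≤ d)
  {Z : (Fin 2 → ℝ) → ℝ}
  (hZ : ∀ p, Z p = gnCutoff ((π + z) ^ 2 / π ^ 2) ((π + z) ^ 2) (p 0 ^ 2) * gnCutoff ((π + z) ^ 2 / π ^ 2) ((π + z) ^ 2) (p 1 ^ 2) *
    ((radialCutoffC (1 / 2) (momToComplex p) * sectorWeightCirc n₁ ((ω₁ : ℕ) : ℤ) (polarAngle p)) *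
      (radialCutoffC (1 / 2) (momToComplex p) * sectorWeightCirc n₂ ((ω₂ : ℕ) : ℤ) (polarAngle p))))
  {Ds : TorusSite 1 (2 * M) × TorusSite 2 L → ℂ}
  (hDs : ∀ q, Ds q = klAnisoFamily L M β μ K' e₀ n₁ ω₁ (⟨(q.1 0).val, ZMod.val_lt (q.1 0)⟩, q.2) *
      klAnisoFamily L M β μ K' e₀ n₂ ω₂ (⟨(q.1 0).val, ZMod.val_lt (q.1 0)⟩, q.2) -
    klAnisoFamily L M β μ K e₀ n₁ ω₁ (⟨(q.1 0).val, ZMod.val_lt (q.1 0)⟩, q.2) *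
      klAnisoFamily L M β μ K e₀ n₂ ω₂ (⟨(q.1 0).val, ZMod.val_lt (q.1 0)⟩, q.2))
  -- the two sampled increment pairs of the split `D = G₁ − G₂`
  (Gs₁ Gs₂ : TorusSite 1 (2 * M) × TorusSite 2 L → ℂ) (hsplit : ∀ q, Ds q = Gs₁ q - Gs₂ q)

include B hA hA' hADt he hz hz1 hgap h3 hlo hhi hβ hρA hn hd hd1 hd2 hZ hDs hsplit in
set_option maxHeartbeats 1600000 in
/-- **Weighted `ℓ¹` of the character sum of the thin-pair frame difference from the pointwise data of its two increment pairs** (see the module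
docstring).  Abstract pointwise bounds: time order three `T₁, T₂`; axes order three `X₁, X₂`; normal step order three `P₁, P₂`; tangent step order two
`W₁, W₂` and order three `V₁, V₂`; sups `S₁, S₂`; thresholds against `A₀` at the rates `s₀ … s₃′`.
[cite: BenfattoGiulianiMastropietro2006, Lemma 2.2 (2.52)–(2.55), §2.6 (2.81), §2.7 (2.71a), §3 (3.3)] -/
theorem charSumWt_thinPairDiff_le_of_pointwise
    (v : Fin 2 → ℤ) (hv : v ≠ 0) {s₀ s₁ s₂ s₃ s₃' : ℝ} (hs₀ : 0 < s₀) (hs₁ : 0 < s₁) (hs₂ : 0 < s₂) (hs₃ : 0 < s₃) (hs₃' : 0 < s₃')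
    {R₀ : ℕ} (hR₀ : 2 * (|v 0| + |v 1|) * (R₀ : ℤ) < L) {A₀ : ℝ} (hA₀ : 0 ≤ A₀)
    {S₁ S₂ T₁ T₂ X₁ X₂ P₁ P₂ W₁ W₂ V₁ V₂ : ℝ}
    (hS₁ : ∀ q, ‖Gs₁ q‖ ≤ S₁) (hS₂ : ∀ q, ‖Gs₂ q‖ ≤ S₂)
    (hT₁ : ∀ q, ‖((fwdDiff ((fun _ : Fin 1 => (1 : ZMod (2 * M))), (0 : TorusSite 2 L)))^[3] Gs₁) q‖ ≤ T₁)
    (hT₂ : ∀ q, ‖((fwdDiff ((fun _ : Fin 1 => (1 : ZMod (2 * M))), (0 : TorusSite 2 L)))^[3] Gs₂) q‖ ≤ T₂)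
    (hX₁ : ∀ q (i : Fin 2), ‖((fwdDiff ((0 : TorusSite 1 (2 * M)), (Pi.single i (1 : ZMod L) : TorusSite 2 L)))^[3] Gs₁) q‖ ≤ X₁)
    (hX₂ : ∀ q (i : Fin 2), ‖((fwdDiff ((0 : TorusSite 1 (2 * M)), (Pi.single i (1 : ZMod L) : TorusSite 2 L)))^[3] Gs₂) q‖ ≤ X₂)
    (hP₁ : ∀ q, ‖((fwdDiff ((0 : TorusSite 1 (2 * M)), (fun j => ((![-v 1, v 0] j : ℤ) : ZMod L))))^[3] Gs₁) q‖ ≤ P₁)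
    (hP₂ : ∀ q, ‖((fwdDiff ((0 : TorusSite 1 (2 * M)), (fun j => ((![-v 1, v 0] j : ℤ) : ZMod L))))^[3] Gs₂) q‖ ≤ P₂)
    (hW₁ : ∀ q, ‖((fwdDiff ((0 : TorusSite 1 (2 * M)), (fun j => ((v j : ℤ) : ZMod L))))^[2] Gs₁) q‖ ≤ W₁)
    (hW₂ : ∀ q, ‖((fwdDiff ((0 : TorusSite 1 (2 * M)), (fun j => ((v j : ℤ) : ZMod L))))^[2] Gs₂) q‖ ≤ W₂)
    (hV₁ : ∀ q, ‖((fwdDiff ((0 : TorusSite 1 (2 * M)), (fun j => ((v j : ℤ) : ZMod L))))^[3] Gs₁) q‖ ≤ V₁)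
    (hV₂ : ∀ q, ‖((fwdDiff ((0 : TorusSite 1 (2 * M)), (fun j => ((v j : ℤ) : ZMod L))))^[3] Gs₂) q‖ ≤ V₂)
    -- the thresholds (the rate file solves them in the two-scale class)
    (tS : S₁ + S₂ ≤ A₀) (tT : T₁ + T₂ ≤ A₀ * (4 / (s₀ * (2 * M : ℕ))) ^ 3) (tX : X₁ + X₂ ≤ A₀ * (4 / (s₁ * L)) ^ 3)
    (tP : P₁ + P₂ ≤ A₀ * (4 / (s₂ * L)) ^ 3) (tW : W₁ + W₂ ≤ A₀ * (4 / (s₃ * L)) ^ 2) (tV : V₁ + V₂ ≤ A₀ * (4 / (s₃' * L)) ^ 3) :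
    ∑ zz : TorusSite 1 (2 * M) × TorusSite 2 L,
        (1 + s₀ * |(((zz.1 0).valMinAbs : ℤ) : ℝ)| + s₁ * |(((zz.2 0).valMinAbs : ℤ) : ℝ)| + s₁ * |(((zz.2 1).valMinAbs : ℤ) : ℝ)|) *
          ‖∑ q : TorusSite 1 (2 * M) × TorusSite 2 L, (torusChar q.1 zz.1 * torusChar q.2 zz.2) • Ds q‖ ≤
      Real.sqrt (524288 * (1 / s₀ + 1) *
          ((1 + 2 * Real.sqrt 2 * s₁ / (s₂ * Real.sqrt ((v 0 : ℝ) ^ 2 + (v 1 : ℝ) ^ 2)) +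
              2 * Real.sqrt 2 * s₁ / (s₃' * Real.sqrt ((v 0 : ℝ) ^ 2 + (v 1 : ℝ) ^ 2))) ^ 2 *
            ((2 * Real.sqrt 2 / (s₂ * Real.sqrt ((v 0 : ℝ) ^ 2 + (v 1 : ℝ) ^ 2)) + 2) *
              (2 * Real.sqrt 2 / (s₃ * Real.sqrt ((v 0 : ℝ) ^ 2 + (v 1 : ℝ) ^ 2)) + 2))
            + (1 / s₁ + 1) ^ 2 / (1 + s₁ * R₀))) *
        Real.sqrt (24 * (2 * M : ℕ) * (L : ℝ) ^ 2 *
          (2 * ((klScale e₀ n₁ * β / π + 1) *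
            ((Real.sqrt 2 * L * ((klScale e₀ n₁ + (4 + 4 * A) *
                ((klScale e₀ n₁ + B.smax * B.Dtmin * (3 * sectorWidth n₂ / 4)) / (B.Dtmin - 2 * A)) ^ 2) / (2 * B.rhomin - 4 * A)) / π + 2) *
              (Real.sqrt 2 * L * (2 * ((klScale e₀ n₁ + B.smax * B.Dtmin * (3 * sectorWidth n₂ / 4)) / (B.Dtmin - 2 * A))) / π + 2))))) * A₀ := by
  classical
  -- `D = G₁ − G₂` as functions, and the iterated differences of a difference
  have hDfun : Ds = fun q => Gs₁ q - Gs₂ q := funext hsplit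
  have hdiff : ∀ (h : TorusSite 1 (2 * M) × TorusSite 2 L) (n : ℕ) (q : TorusSite 1 (2 * M) × TorusSite 2 L) {b₁ b₂ : ℝ},
      ‖((fwdDiff h)^[n] Gs₁) q‖ ≤ b₁ → ‖((fwdDiff h)^[n] Gs₂) q‖ ≤ b₂ → ‖((fwdDiff h)^[n] Ds) q‖ ≤ b₁ + b₂ := by
    intro h n q b₁ b₂ h₁ h₂
    rw [hDfun, fwdDiff_iter_sub_apply]
    exact (norm_sub_le _ _).trans (add_le_add h₁ h₂)
  -- the master lemma's inputs
  have hsup : ∀ q, ‖Ds q‖ ≤ A₀ := fun q => by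
    rw [hsplit]; exact (norm_sub_le _ _).trans ((add_le_add (hS₁ q) (hS₂ q)).trans tS)
  have m0 : ∀ q, ‖((fwdDiff ((fun _ : Fin 1 => (1 : ZMod (2 * M))), (0 : TorusSite 2 L)))^[3] Ds) q‖ ≤ A₀ * (4 / (s₀ * (2 * M : ℕ))) ^ 3 :=
    fun q => (hdiff _ 3 q (hT₁ q) (hT₂ q)).trans tT
  have m1 : ∀ q (i : Fin 2), ‖((fwdDiff ((0 : TorusSite 1 (2 * M)), (Pi.single i (1 : ZMod L) : TorusSite 2 L)))^[3] Ds) q‖ ≤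
      A₀ * (4 / (s₁ * L)) ^ 3 := fun q i => (hdiff _ 3 q (hX₁ q i) (hX₂ q i)).trans tX
  have m2 : ∀ q, ‖((fwdDiff ((0 : TorusSite 1 (2 * M)), (fun j => ((![-v 1, v 0] j : ℤ) : ZMod L))))^[3] Ds) q‖ ≤ A₀ * (4 / (s₂ * L)) ^ 3 :=
    fun q => (hdiff _ 3 q (hP₁ q) (hP₂ q)).trans tP
  have m3 : ∀ q, ‖((fwdDiff ((0 : TorusSite 1 (2 * M)), (fun j => ((v j : ℤ) : ZMod L))))^[2] Ds) q‖ ≤ A₀ * (4 / (s₃ * L)) ^ 2 :=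
    fun q => (hdiff _ 2 q (hW₁ q) (hW₂ q)).trans tW
  have m3' : ∀ q, ‖((fwdDiff ((0 : TorusSite 1 (2 * M)), (fun j => ((v j : ℤ) : ZMod L))))^[3] Ds) q‖ ≤ A₀ * (4 / (s₃' * L)) ^ 3 :=
    fun q => (hdiff _ 3 q (hV₁ q) (hV₂ q)).trans tV
  -- the support count of the difference (k3c4-p2)
  have hNs := card_support_thinPairDiff_le B hA hA' hADt he hz hz1 hgap h3 hlo hhi hβ hρA hn ω₁ ω₂ hd hd1 hd2 hZ hDs
  -- the master lemma with `N_s :=` the support itself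
  have main := sum_wt_norm_charSum_le_of_mixed_differences Ds v hv hs₀ hs₁ hs₂ hs₃ hs₃' hR₀ hA₀ (le_refl _) hsup m0 m1 m2 m3 m3'
  refine main.trans ?_
  gcongr

end ThinPairDiffWt

end Summit.HubbardSuperconductivity.HubbardSuperconductivity.Theorems.TorusFourierL2

end
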